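import Summits.BirchSwinnertonDyer.Rank1Residual.X11b.KummerRelaxationIndexExact
import Literature.NumberTheory.GaloisCohomology.ArchimedeanInvariantMap
import Literature.NumberTheory.GaloisRepresentations.LocalEulerPoincareCharacteristicProofs
import HarnessLib

/-!
# Route `GenusKolyvaginAtTwo`, crux L_T `PowDvdShaCardAtTwoRT` (stmt-BirchSwinnertonDyer-23242), LINE 18 stub L, bottom rung:
# THE LOCAL KUMMER CONDITION IS LAGRANGIAN FOR `inv_v(· ∪ₑ ·)` — `{}^⊥𝓛_v = 𝓛_v = 𝓛_v^⊥`, UNCONDITIONALLY at prime-power level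

Width seat `bsd-line-gk2-p4` g18 (cell `bsd-f1-sign2`), `--supports 23242 --as helper`.  THEOREMS ONLY (no definition, no named fact,
no `sorry`; standard axioms).  BSD is NOT proved by any of this; neither is the crux nor stub L.

WHY (LEAD memo `Cruxes/PowDvdShaCardAtTwoRT/Lines/plus-descent-lead-g16.md` §2, STATUS 06:36:57Z «Lagrangian of `𝓛_{ℓ′}` for
`invWeilPairing` (gk2-p4)»).  The `ℓ′`-term of the bottom-rung reciprocity is shown NON-zero by the LEAD's
`RelaxedCount.pairing_two_nsmul_ne_zero_of_lagrangian` (p701826), whose hypothesis `hF : {}^⊥F ≤ F` is the coisotropy of the local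
Kummer condition `F = 𝓛_{ℓ′} ≤ H¹(ℚ_{ℓ′}, E[4])` for the pairing `b = inv_{ℓ′}(· ∪ₑ ·)` (`invWeilPairing`).  X11b has the right-handed
statement `KummerPT.annRight_invWeilPairing_kummer_eq` and the membership form `KummerPT.forall_mem_kummer_invWeilPairing_eq_zero_iff`,
both MODULO Tate's count `hEuler`; this file packages the LEFT annihilator and DISCHARGES the count (tree
`natCard_galoisCohomology_one_torsion_adicCompletion_eq_sq` + `localEulerPoincareCharacteristic_holds`), at every finite place of every
number field, for every prime-power level `p^k` (`k ≥ 1`), for ANY family `inv` injective at `v`, and for THE canonical family.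
* `annLeft_invWeilPairing_kummer_eq_of_eulerChar` — `{}^⊥𝓛_v = 𝓛_v` modulo `hEuler` (= `forall_mem_kummer_invWeilPairing_eq_zero_iff`, `ext`).
* **`annLeft_invWeilPairing_kummer_eq`** / **`annRight_invWeilPairing_kummer_eq'`** — unconditional (`k ≠ 0`, `inv_v` injective).
* `annLeft_invWeilPairing_kummer_eq_canonical` / `annRight_…_canonical` — for `LocalInvariants.canonical K (p^k)` (`canonical_isPerfect`).
* `annLeft_invWeilPairing_kummer_le(_canonical)` — the `hF`-shape `{}^⊥𝓛_v ≤ 𝓛_v` consumed by `pairing_two_nsmul_ne_zero_of_lagrangian`.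
HONEST FRAMING: one-line packaging of tree theorems (Tate local duality for `E[n]` off and at `p`, Milne I Cor. 3.4 / Lemma 6.15);
closes nothing.  BSD is NOT proved by any of this.

References: [MilneADT2006] Ch. I Cor. 2.3, Thm. 2.8, Cor. 3.4, Lemma 6.15; [PoonenRains2012] Prop. 4.10; [McCallumLMS1991] §5 Lemma 5.3.
-/

set_option autoImplicit false

noncomputable section

open scoped Classical

open CategoryTheory Field NumberField IsDedekindDomain Function
open Literature.NumberTheory.EllipticCurves
open Literature.NumberTheory.GaloisRepresentations
open Literature.NumberTheory.GaloisCohomology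
open Summit.BirchSwinnertonDyer.Rank1Residual.X11b.KummerPT
open Summit.BirchSwinnertonDyer.Rank1Residual.X11b.FiniteDuality
open Summit.BirchSwinnertonDyer.Rank1Residual.X11b.Relaxation
open scoped ContRepresentation

-- the Theorems namespace of this sub repeats the summit name by design (D-0017 nested layout)
set_option linter.dupNamespace false

namespace Summit.BirchSwinnertonDyer.BirchSwinnertonDyer.Theorems.GenusExact.KummerLagrangian

variable {K : Type} [Field K] [NumberField K] (W : WeierstrassCurve K) [W.IsElliptic] (p k : ℕ) [Fact p.Prime]
variable (e : W.geomTorsion ((p ^ k : ℕ) : ℤ) → W.geomTorsion ((p ^ k : ℕ) : ℤ) → AlgebraicClosure K)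
  (hμ : ∀ S T, e S T ^ (p ^ k) = 1)
  (hadd₁ : ∀ S₁ S₂ T, e (S₁ + S₂) T = e S₁ T * e S₂ T)
  (hadd₂ : ∀ S T₁ T₂, e S (T₁ + T₂) = e S T₁ * e S T₂)
  (hgal : ∀ (σ : absoluteGaloisGroup K) (S T : W.geomTorsion ((p ^ k : ℕ) : ℤ)), σ • e S T = e (σ • S) (σ • T))
  (halt : ∀ T, e T T = 1) (hnondeg : ∀ T, (∀ S, e S T = 1) → T = 0)
  (v : HeightOneSpectrum (𝓞 K))

/-- **Tate's count at every finite place, prime-power level** (`k ≠ 0`): `#H¹(K_v, E[p^k]) = (#E(K_v)[p^k] · #(𝓞_v/p^k))²` — the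
`hEuler` input of X11b's duality lemmas, discharged by the tree's `localEulerPoincareCharacteristic_holds`.
[cite: MilneADT2006, Ch. I, Thm. 2.8] -/
theorem eulerChar_toLocal_pow (hk : k ≠ 0) :
    Nat.card (galoisCohomology ((W.torsionGaloisModule ((p ^ k : ℕ) : ℤ)).toLocal (Sum.inr v)) 1) =
      (Nat.card (nsmulAddMonoidHom (p ^ k) : (W.baseChange (v.adicCompletion K)).toAffine.Point →+ _).ker *
        Nat.card (v.adicCompletionIntegers K ⧸ Ideal.span {((p ^ k : ℕ) : v.adicCompletionIntegers K)})) ^ 2 := by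
  haveI : CharZero (v.adicCompletion K) := charZero_adicCompletion v
  exact natCard_galoisCohomology_one_torsion_adicCompletion_eq_sq W v (p ^ k)
    ⟨p, k, (Fact.out : p.Prime).prime, Nat.pos_of_ne_zero hk, rfl⟩ (LocalEPC.localEulerPoincareCharacteristic_holds (v.adicCompletion K))

include halt hnondeg in
/-- **`{}^⊥𝓛_v = 𝓛_v` modulo Tate's count**: the left annihilator of the local Kummer condition under `inv_v(· ∪ₑ ·)` is the Kummer
condition (X11b `forall_mem_kummer_invWeilPairing_eq_zero_iff`, extensionality). [cite: MilneADT2006, Ch. I, Cor. 3.4 and Lemma 6.15] -/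
theorem annLeft_invWeilPairing_kummer_eq_of_eulerChar {inv : LocalInvariants K (p ^ k)} (hinv : Injective (inv (Sum.inr v)))
    (hEuler : Nat.card (galoisCohomology ((W.torsionGaloisModule ((p ^ k : ℕ) : ℤ)).toLocal (Sum.inr v)) 1) =
      (Nat.card (nsmulAddMonoidHom (p ^ k) : (W.baseChange (v.adicCompletion K)).toAffine.Point →+ _).ker *
        Nat.card (v.adicCompletionIntegers K ⧸ Ideal.span {((p ^ k : ℕ) : v.adicCompletionIntegers K)})) ^ 2) :
    annLeft (invWeilPairing W (p ^ k) e hμ hadd₁ hadd₂ hgal inv (Sum.inr v)) (W.kummerSelmerStructure ((p ^ k : ℕ) : ℤ) (Sum.inr v)) =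
      W.kummerSelmerStructure ((p ^ k : ℕ) : ℤ) (Sum.inr v) := by
  ext t
  rw [mem_annLeft_iff]
  exact forall_mem_kummer_invWeilPairing_eq_zero_iff W p k e hμ hadd₁ hadd₂ hgal halt hnondeg v hinv hEuler t

include halt hnondeg in
/-- **`{}^⊥𝓛_v = 𝓛_v`, unconditionally** (`k ≥ 1`, `inv_v` injective): the local Kummer condition is LAGRANGIAN for `inv_v(· ∪ₑ ·)` on the
left. [cite: MilneADT2006, Ch. I, Cor. 3.4 and Lemma 6.15] [cite: PoonenRains2012, Prop. 4.10] -/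
theorem annLeft_invWeilPairing_kummer_eq (hk : k ≠ 0) {inv : LocalInvariants K (p ^ k)} (hinv : Injective (inv (Sum.inr v))) :
    annLeft (invWeilPairing W (p ^ k) e hμ hadd₁ hadd₂ hgal inv (Sum.inr v)) (W.kummerSelmerStructure ((p ^ k : ℕ) : ℤ) (Sum.inr v)) =
      W.kummerSelmerStructure ((p ^ k : ℕ) : ℤ) (Sum.inr v) :=
  annLeft_invWeilPairing_kummer_eq_of_eulerChar W p k e hμ hadd₁ hadd₂ hgal halt hnondeg v hinv (eulerChar_toLocal_pow W p k v hk)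

include halt hnondeg in
/-- **`𝓛_v^⊥ = 𝓛_v`, unconditionally** (right annihilator; X11b `annRight_invWeilPairing_kummer_eq` with Tate's count discharged).
[cite: MilneADT2006, Ch. I, Cor. 3.4 and Lemma 6.15] -/
theorem annRight_invWeilPairing_kummer_eq' (hk : k ≠ 0) {inv : LocalInvariants K (p ^ k)} (hinv : Injective (inv (Sum.inr v))) :
    annRight (invWeilPairing W (p ^ k) e hμ hadd₁ hadd₂ hgal inv (Sum.inr v)) (W.kummerSelmerStructure ((p ^ k : ℕ) : ℤ) (Sum.inr v)) =
      W.kummerSelmerStructure ((p ^ k : ℕ) : ℤ) (Sum.inr v) := by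
  haveI : NeZero (p ^ k) := ⟨pow_ne_zero k (Fact.out : p.Prime).ne_zero⟩
  exact annRight_invWeilPairing_kummer_eq W (p ^ k) e hμ hadd₁ hadd₂ hgal halt hnondeg inv v hinv (eulerChar_toLocal_pow W p k v hk)

include halt hnondeg in
/-- **The `hF`-shape `{}^⊥𝓛_v ≤ 𝓛_v`** (the coisotropy hypothesis of `RelaxedCount.pairing_two_nsmul_ne_zero_of_lagrangian` at `ℓ′`).
[cite: MilneADT2006, Ch. I, Cor. 3.4] -/
theorem annLeft_invWeilPairing_kummer_le (hk : k ≠ 0) {inv : LocalInvariants K (p ^ k)} (hinv : Injective (inv (Sum.inr v))) :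
    annLeft (invWeilPairing W (p ^ k) e hμ hadd₁ hadd₂ hgal inv (Sum.inr v)) (W.kummerSelmerStructure ((p ^ k : ℕ) : ℤ) (Sum.inr v)) ≤
      W.kummerSelmerStructure ((p ^ k : ℕ) : ℤ) (Sum.inr v) :=
  (annLeft_invWeilPairing_kummer_eq W p k e hμ hadd₁ hadd₂ hgal halt hnondeg v hk hinv).le

include halt hnondeg in
/-- **`{}^⊥𝓛_v = 𝓛_v` for THE canonical family** `LocalInvariants.canonical K (p^k)` (injective at every finite place by
`canonical_isPerfect`). [cite: MilneADT2006, Ch. I, Cor. 2.3, Cor. 3.4] -/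
theorem annLeft_invWeilPairing_kummer_eq_canonical (hk : k ≠ 0) :
    annLeft (invWeilPairing W (p ^ k) e hμ hadd₁ hadd₂ hgal (LocalInvariants.canonical K (p ^ k)) (Sum.inr v))
        (W.kummerSelmerStructure ((p ^ k : ℕ) : ℤ) (Sum.inr v)) =
      W.kummerSelmerStructure ((p ^ k : ℕ) : ℤ) (Sum.inr v) :=
  annLeft_invWeilPairing_kummer_eq W p k e hμ hadd₁ hadd₂ hgal halt hnondeg v hk
    ((LocalInvariants.canonical_isPerfect (K := K) (n := p ^ k)) v).1.1

include halt hnondeg in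
/-- **`𝓛_v^⊥ = 𝓛_v` for THE canonical family.** [cite: MilneADT2006, Ch. I, Cor. 2.3, Cor. 3.4] -/
theorem annRight_invWeilPairing_kummer_eq_canonical (hk : k ≠ 0) :
    annRight (invWeilPairing W (p ^ k) e hμ hadd₁ hadd₂ hgal (LocalInvariants.canonical K (p ^ k)) (Sum.inr v))
        (W.kummerSelmerStructure ((p ^ k : ℕ) : ℤ) (Sum.inr v)) =
      W.kummerSelmerStructure ((p ^ k : ℕ) : ℤ) (Sum.inr v) :=
  annRight_invWeilPairing_kummer_eq' W p k e hμ hadd₁ hadd₂ hgal halt hnondeg v hk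
    ((LocalInvariants.canonical_isPerfect (K := K) (n := p ^ k)) v).1.1

include halt hnondeg in
/-- **The `hF`-shape for THE canonical family.** [cite: MilneADT2006, Ch. I, Cor. 3.4] -/
theorem annLeft_invWeilPairing_kummer_le_canonical (hk : k ≠ 0) :
    annLeft (invWeilPairing W (p ^ k) e hμ hadd₁ hadd₂ hgal (LocalInvariants.canonical K (p ^ k)) (Sum.inr v))
        (W.kummerSelmerStructure ((p ^ k : ℕ) : ℤ) (Sum.inr v)) ≤
      W.kummerSelmerStructure ((p ^ k : ℕ) : ℤ) (Sum.inr v) :=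
  (annLeft_invWeilPairing_kummer_eq_canonical W p k e hμ hadd₁ hadd₂ hgal halt hnondeg v hk).le

end Summit.BirchSwinnertonDyer.BirchSwinnertonDyer.Theorems.GenusExact.KummerLagrangian

end
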